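import Literature.Barriers.NavierStokesRegularity.NavierStokesInequalityProfileSlices
import Literature.Barriers.NavierStokesRegularity.NavierStokesInequalityPressureContinuity
import Literature.Barriers.NavierStokesRegularity.NavierStokesInequalityProfileConvergence
import Literature.Barriers.NavierStokesRegularity.NavierStokesInequalityStructureCompactness
import Literature.Analysis.FluidPDE.LerayProfileCalculus
import HarnessLib

/-!
# Uniform bounds for the fields `u[bv, q]` near a fixed profile (Ożański 2017, §6.3 Step 3, (6.26) and (iv))

Barrier catalogue support file for `NavierStokesRegularity` (D-0021), on the discharge path of
fact D′ `Literature.Barriers.NavierStokesRegularity.NSICantorBlock_of_arrangement`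
(`NavierStokesInequalityCantorArrangement`; W. S. Ożański, arXiv:1709.00602v4, §6.3). In Step 3 of
§6.3 two bounds must hold with constants INDEPENDENT of the generation `j` (and of the pair
`𝔪` and the index `k` of the oscillatory processes): the viscosity threshold (6.26),
`ν₀|u[a v_i^𝔪, q^{𝔪,k}_{i,t}]·Δu[a v_i^𝔪, q^{𝔪,k}_{i,t}]| ≤ δ/4` ("see Lemma A.2 for a verification
that (6.21) is sufficient"), and the pointwise bounds behind (iv),
`|v| ≤ 𝒞`, `|∇v(x,t)| ≤ max_𝔪 𝒞(‖v_1^𝔪 + v_2^𝔪‖_{W^{1,∞}}, ‖h^𝔪_{1,s} + h^𝔪_{2,s}‖_{W^{1,∞}} + 1) = 𝒞`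
("for sufficiently large `k`, `‖q^{𝔪,k}_{1,t} + q^{𝔪,k}_{2,t}‖_{W^{1,∞}} ≤ ‖h^𝔪_{1,t} + h^𝔪_{2,t}‖_{W^{1,∞}} + 1`,
by (6.21)). Since all pairs are translates of one pair, it suffices to bound, for ONE structure
`(v, f, φ)` on `U` with the profiles `h_t = H t` of Lemma 4.1, the fields `u[bv, q]` for all
`|b| ≤ 1` and all profiles `q` that are `C²`-close to some `h_t`, `t ∈ [0,T]` (and equal to it
on `{φ < 1}`, as the profiles (6.20) are). This file PROVES such a uniform statement
(`IsNSIStructure.exists_uniform_swirl_bounds`): there are `ε₀ > 0` and `Λ` with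

* `q² ≤ Λ`, `|∇u[bv,q]|² ≤ Λ` and `u[bv,q]·Δu[bv,q] ≥ -Λ` everywhere,

whenever `(bv, q, χ)` is a structure on `U`, `q = h_t` on `{φ < 1}` and
`|q² - h_t²|, ‖∇(q² - h_t²)‖, ‖∇²(q² - h_t²)‖ ≤ ε₀`. The lower bound on `u·Δu` is all that (6.26)
needs (the upper bound is never used in the Navier–Stokes inequality), and it follows from the
pointwise identity `u·Δu = ½Δ|u|² - |∇u|²` (the tree's `laplacian_inner_self_eq`) with
`|u|² = q² ∘ R⁻¹` ((3.11)): `Δ(q² ∘ R⁻¹) = ∂ᵣ∂ᵣq² + r⁻¹∂ᵣq² + ∂_z∂_zq²` is `C²`-controlled, and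
`|∇u|` is bounded through the representation `u = (v_r/r)(x₀,x₁,0) + v_z x̂ + (√(q²-|v|²)/r) Jx`
(`swirlField_eq_linear`) with first derivatives only — on `{φ < 1}` the swirl profile IS `h_t`,
on `{φ > 1/2}` the radicand stays above a fixed margin. This replaces the continuity lemmas A.2–A.3
of the appendix by compactness over `[0,T] × Ū` for the fixed data `(v, H)`.

## References

* W. S. Ożański, *On weak solutions to the Navier–Stokes inequality with internal
  singularities*, arXiv:1709.00602v4, §6.3 Step 3 ((6.26), (iv)), Appendix A (Lemmas A.2–A.3),
  §3.3 (3.11). [`Ozanski2017NSISingular`]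
* V. Scheffer, *Nearly one dimensional singularities of solutions to the Navier–Stokes
  inequality*, Comm. Math. Phys. 110 (1987), Lemma 3.2 ((3.27)–(3.33)). [`Scheffer1987`]
-/

noncomputable section

open Set Function Filter Topology Metric MeasureTheory
open scoped InnerProductSpace RealInnerProductSpace ContDiff Laplacian

namespace Literature.Barriers.NavierStokesRegularity

open Literature.Analysis.FluidPDE

-- nested operator types (second derivatives)
set_option maxSynthPendingDepth 3

/-! ### Linear algebra of the cylindrical frame fields -/

/-- `‖(y₀, y₁, 0)‖ ≤ ‖y‖`. [folklore] -/
theorem norm_horizontal_le (y : EuclideanSpace ℝ (Fin 3)) :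
    ‖(WithLp.toLp 2 ![y 0, y 1, 0] : EuclideanSpace ℝ (Fin 3))‖ ≤ ‖y‖ := by
  rw [EuclideanSpace.norm_eq, EuclideanSpace.norm_eq]
  refine Real.sqrt_le_sqrt ?_
  simp only [Fin.sum_univ_three, Real.norm_eq_abs, sq_abs]
  simp
  nlinarith [sq_nonneg (y 2)]

/-- `‖Jy‖ ≤ ‖y‖` for the rotation generator `Jy = (-y₁, y₀, 0)`. [folklore] -/
theorem norm_rotGen_le (y : EuclideanSpace ℝ (Fin 3)) : ‖rotGen y‖ ≤ ‖y‖ := by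
  rw [EuclideanSpace.norm_eq, EuclideanSpace.norm_eq]
  refine Real.sqrt_le_sqrt ?_
  simp only [Fin.sum_univ_three, Real.norm_eq_abs, sq_abs, rotGen_apply_zero, rotGen_apply_one,
    rotGen_apply_two]
  nlinarith [sq_nonneg (y 2)]

/-- The operator norm of the rotation generator is at most one. [folklore] -/
theorem norm_rotGenL_le : ‖(rotGenL : EuclideanSpace ℝ (Fin 3) →L[ℝ] EuclideanSpace ℝ (Fin 3))‖ ≤ 1 :=
  ContinuousLinearMap.opNorm_le_bound _ zero_le_one fun y => by
    rw [one_mul, rotGenL_apply]; exact norm_rotGen_le y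

/-- The horizontal projection as a continuous linear map, `y ↦ y - y₂ x̂_axis`. [folklore] -/
theorem horizontalL_apply (y : EuclideanSpace ℝ (Fin 3)) :
    (ContinuousLinearMap.id ℝ (EuclideanSpace ℝ (Fin 3)) -
        (EuclideanSpace.proj (2 : Fin 3) : EuclideanSpace ℝ (Fin 3) →L[ℝ] ℝ).smulRight eZ) y =
      (WithLp.toLp 2 ![y 0, y 1, 0] : EuclideanSpace ℝ (Fin 3)) :=
  (horizontal_eq_clm y).symm

/-- The operator norm of the horizontal projection is at most one. [folklore] -/
theorem norm_horizontalL_le :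
    ‖ContinuousLinearMap.id ℝ (EuclideanSpace ℝ (Fin 3)) -
        (EuclideanSpace.proj (2 : Fin 3) : EuclideanSpace ℝ (Fin 3) →L[ℝ] ℝ).smulRight eZ‖ ≤ 1 :=
  ContinuousLinearMap.opNorm_le_bound _ zero_le_one fun y => by
    rw [one_mul, horizontalL_apply]; exact norm_horizontal_le y

/-- `|L|²_F ≤ 3‖L‖²` for a linear map on `ℝ³` (three unit vectors). [folklore] -/
theorem frobeniusNormSq_le_three_mul (L : EuclideanSpace ℝ (Fin 3) →L[ℝ] EuclideanSpace ℝ (Fin 3)) :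
    frobeniusNormSq L ≤ 3 * ‖L‖ ^ 2 := by
  set b := stdOrthonormalBasis ℝ (EuclideanSpace ℝ (Fin 3))
  have h1 : ∀ i, ‖L (b i)‖ ^ 2 ≤ ‖L‖ ^ 2 := fun i => by
    have := L.le_opNorm (b i)
    rw [b.orthonormal.1 i, mul_one] at this
    exact pow_le_pow_left₀ (norm_nonneg _) this 2
  calc frobeniusNormSq L = ∑ i, ‖L (b i)‖ ^ 2 := rfl
    _ ≤ ∑ _i, ‖L‖ ^ 2 := Finset.sum_le_sum fun i _ => h1 i
    _ = 3 * ‖L‖ ^ 2 := by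
      rw [Finset.sum_const, Finset.card_univ, nsmul_eq_mul]
      simp [finrank_euclideanSpace]

/-! ### Planar calculus: norms of `∂_z` and of `D(∂_zσ)` -/

/-- `|∂_zσ(q)| ≤ ‖Dσ(q)‖`. [folklore] -/
theorem abs_derivZ_le (σ : ℝ × ℝ → ℝ) (q : ℝ × ℝ) : |derivZ σ q| ≤ ‖fderiv ℝ σ q‖ := by
  rw [derivZ, ← Real.norm_eq_abs]
  refine (ContinuousLinearMap.le_opNorm _ _).trans ?_
  rw [Prod.norm_def]; simp

/-- `‖D(∂_zσ)(q)‖ ≤ ‖D²σ(q)‖` for `σ ∈ C²`. [folklore] -/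
theorem norm_fderiv_derivZ_le {σ : ℝ × ℝ → ℝ} (hσ : ContDiff ℝ 2 σ) (q : ℝ × ℝ) :
    ‖fderiv ℝ (derivZ σ) q‖ ≤ ‖fderiv ℝ (fderiv ℝ σ) q‖ := by
  have hd : DifferentiableAt ℝ (fderiv ℝ σ) q :=
    ((hσ.fderiv_right (m := 1) le_rfl).differentiable one_ne_zero) q
  have h : derivZ σ = fun q' => fderiv ℝ σ q' ((0 : ℝ), (1 : ℝ)) := rfl
  rw [h, fderiv_clm_apply hd (differentiableAt_const _)]
  simp only [fderiv_fun_const, Pi.zero_apply, ContinuousLinearMap.comp_zero, zero_add]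
  refine ContinuousLinearMap.opNorm_le_bound _ (norm_nonneg _) fun h' => ?_
  rw [ContinuousLinearMap.flip_apply]
  calc ‖fderiv ℝ (fderiv ℝ σ) q h' ((0 : ℝ), (1 : ℝ))‖
      ≤ ‖fderiv ℝ (fderiv ℝ σ) q h'‖ * ‖((0 : ℝ), (1 : ℝ))‖ := ContinuousLinearMap.le_opNorm _ _
    _ ≤ ‖fderiv ℝ (fderiv ℝ σ) q‖ * ‖h'‖ * ‖((0 : ℝ), (1 : ℝ))‖ := by
        gcongr; exact ContinuousLinearMap.le_opNorm _ _
    _ = ‖fderiv ℝ (fderiv ℝ σ) q‖ * ‖h'‖ := by rw [Prod.norm_def]; simp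

/-- The four second partials and the two first partials of a `C²` planar function are bounded by
the operator norms of `Dσ` and `D²σ`. [folklore] -/
theorem abs_derivs_le {σ : ℝ × ℝ → ℝ} (hσ : ContDiff ℝ 2 σ) (q : ℝ × ℝ) :
    |derivR σ q| ≤ ‖fderiv ℝ σ q‖ ∧ |derivZ σ q| ≤ ‖fderiv ℝ σ q‖ ∧
      |derivR (derivR σ) q| ≤ ‖fderiv ℝ (fderiv ℝ σ) q‖ ∧
      |derivZ (derivZ σ) q| ≤ ‖fderiv ℝ (fderiv ℝ σ) q‖ :=
  ⟨abs_derivR_le σ q, abs_derivZ_le σ q,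
    (abs_derivR_le _ q).trans (norm_fderiv_derivR_le hσ q),
    (abs_derivZ_le _ q).trans (norm_fderiv_derivZ_le hσ q)⟩

/-- `∂ᵣ` is additive on `C¹` functions (as functions). [folklore] -/
theorem derivR_add_eq {g₁ g₂ : ℝ × ℝ → ℝ} (h₁ : Differentiable ℝ g₁) (h₂ : Differentiable ℝ g₂) :
    derivR (fun y => g₁ y + g₂ y) = fun q => derivR g₁ q + derivR g₂ q := by
  funext q; simp only [derivR, fderiv_fun_add (h₁ q) (h₂ q), _root_.add_apply]

/-- `∂_z` is additive on `C¹` functions (as functions). [folklore] -/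
theorem derivZ_add_eq {g₁ g₂ : ℝ × ℝ → ℝ} (h₁ : Differentiable ℝ g₁) (h₂ : Differentiable ℝ g₂) :
    derivZ (fun y => g₁ y + g₂ y) = fun q => derivZ g₁ q + derivZ g₂ q := by
  funext q; simp only [derivZ, fderiv_fun_add (h₁ q) (h₂ q), _root_.add_apply]

/-- `∂ᵣ` of a `C^∞` function is `C^∞`. [folklore] -/
theorem contDiff_derivR {g : ℝ × ℝ → ℝ} (hg : ContDiff ℝ ∞ g) : ContDiff ℝ ∞ (derivR g) :=
  (hg.fderiv_right (m := ∞) (by simp)).clm_apply contDiff_const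

/-- `∂_z` of a `C^∞` function is `C^∞`. [folklore] -/
theorem contDiff_derivZ {g : ℝ × ℝ → ℝ} (hg : ContDiff ℝ ∞ g) : ContDiff ℝ ∞ (derivZ g) :=
  (hg.fderiv_right (m := ∞) (by simp)).clm_apply contDiff_const

/-- **Perturbation of the cylindrical planar Laplacian**: for `C^∞` functions `g, h` with
`‖D(g-h)‖ ≤ ε`, `‖D²(g-h)‖ ≤ ε` at `q` and `0 < r₀ ≤ q₁`,
`|(∂ᵣ∂ᵣ + q₁⁻¹∂ᵣ + ∂_z∂_z)g(q) - (∂ᵣ∂ᵣ + q₁⁻¹∂ᵣ + ∂_z∂_z)h(q)| ≤ (2 + r₀⁻¹)ε`. [folklore] -/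
theorem abs_planarLap_sub_le {g h : ℝ × ℝ → ℝ} (hg : ContDiff ℝ ∞ g) (hh : ContDiff ℝ ∞ h)
    {q : ℝ × ℝ} {r₀ ε : ℝ} (hr₀ : 0 < r₀) (hq : r₀ ≤ q.1)
    (h1 : ‖fderiv ℝ (fun y => g y - h y) q‖ ≤ ε)
    (h2 : ‖fderiv ℝ (fderiv ℝ fun y => g y - h y) q‖ ≤ ε) :
    |(derivR (derivR g) q + q.1⁻¹ * derivR g q + derivZ (derivZ g) q) -
        (derivR (derivR h) q + q.1⁻¹ * derivR h q + derivZ (derivZ h) q)| ≤ (2 + r₀⁻¹) * ε := by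
  set D : ℝ × ℝ → ℝ := fun y => g y - h y with hD
  have hDs : ContDiff ℝ ∞ D := hg.sub hh
  have hε : 0 ≤ ε := (norm_nonneg _).trans h1
  have hgd : Differentiable ℝ g := hg.differentiable (by simp)
  have hhd : Differentiable ℝ h := hh.differentiable (by simp)
  have hDd : Differentiable ℝ D := hDs.differentiable (by simp)
  -- `g = D + h`
  have eg : g = fun y => D y + h y := by funext y; simp [hD]
  have eR1 : derivR g = fun q => derivR D q + derivR h q := by rw [eg]; exact derivR_add_eq hDd hhd
  have eZ1 : derivZ g = fun q => derivZ D q + derivZ h q := by rw [eg]; exact derivZ_add_eq hDd hhd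
  have eR2 : derivR (derivR g) q = derivR (derivR D) q + derivR (derivR h) q := by
    rw [eR1, derivR_add_eq ((contDiff_derivR hDs).differentiable (by simp))
      ((contDiff_derivR hh).differentiable (by simp))]
  have eZ2 : derivZ (derivZ g) q = derivZ (derivZ D) q + derivZ (derivZ h) q := by
    rw [eZ1, derivZ_add_eq ((contDiff_derivZ hDs).differentiable (by simp))
      ((contDiff_derivZ hh).differentiable (by simp))]
  have eR1q : derivR g q = derivR D q + derivR h q := by rw [eR1]
  obtain ⟨a1, -, a3, a4⟩ := abs_derivs_le (contDiff_infty.1 hDs 2) q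
  have b1 : |derivR D q| ≤ ε := a1.trans h1
  have b3 : |derivR (derivR D) q| ≤ ε := a3.trans h2
  have b4 : |derivZ (derivZ D) q| ≤ ε := a4.trans h2
  have hq0 : 0 < q.1 := hr₀.trans_le hq
  have hqi : q.1⁻¹ ≤ r₀⁻¹ := inv_anti₀ hr₀ hq
  have e : (derivR (derivR g) q + q.1⁻¹ * derivR g q + derivZ (derivZ g) q) -
      (derivR (derivR h) q + q.1⁻¹ * derivR h q + derivZ (derivZ h) q) =
      derivR (derivR D) q + q.1⁻¹ * derivR D q + derivZ (derivZ D) q := by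
    rw [eR2, eZ2, eR1q]; ring
  rw [e]
  calc |derivR (derivR D) q + q.1⁻¹ * derivR D q + derivZ (derivZ D) q|
      ≤ |derivR (derivR D) q| + |q.1⁻¹ * derivR D q| + |derivZ (derivZ D) q| := abs_add_three _ _ _
    _ = |derivR (derivR D) q| + q.1⁻¹ * |derivR D q| + |derivZ (derivZ D) q| := by
        rw [abs_mul, abs_of_pos (inv_pos.2 hq0)]
    _ ≤ ε + r₀⁻¹ * ε + ε := by gcongr
    _ = (2 + r₀⁻¹) * ε := by ring

/-! ### The derivative of a combination of the frame fields -/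

/-- **Derivative of `y ↦ α(R⁻¹y)(y₀,y₁,0) + β(R⁻¹y)x̂_axis + γ(R⁻¹y)Jy` off the axis** (product
and chain rules through `R⁻¹ = meridian`). [folklore] -/
theorem hasFDerivAt_frameComb {α β γ : ℝ × ℝ → ℝ} {x : EuclideanSpace ℝ (Fin 3)}
    (hx : cylRadius x ≠ 0) (hα : DifferentiableAt ℝ α (meridian x))
    (hβ : DifferentiableAt ℝ β (meridian x)) (hγ : DifferentiableAt ℝ γ (meridian x)) :
    HasFDerivAt (fun y : EuclideanSpace ℝ (Fin 3) =>
        α (meridian y) • (WithLp.toLp 2 ![y 0, y 1, 0] : EuclideanSpace ℝ (Fin 3)) +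
          β (meridian y) • eZ + γ (meridian y) • rotGen y)
      (α (meridian x) • (ContinuousLinearMap.id ℝ (EuclideanSpace ℝ (Fin 3)) -
            (EuclideanSpace.proj (2 : Fin 3) : EuclideanSpace ℝ (Fin 3) →L[ℝ] ℝ).smulRight eZ) +
          ((fderiv ℝ α (meridian x)).comp
              ((innerSL ℝ (eR x)).prod (EuclideanSpace.proj (2 : Fin 3)))).smulRight
            (WithLp.toLp 2 ![x 0, x 1, 0] : EuclideanSpace ℝ (Fin 3)) +
        ((fderiv ℝ β (meridian x)).comp
            ((innerSL ℝ (eR x)).prod (EuclideanSpace.proj (2 : Fin 3)))).smulRight eZ +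
        (γ (meridian x) • rotGenL +
          ((fderiv ℝ γ (meridian x)).comp
              ((innerSL ℝ (eR x)).prod (EuclideanSpace.proj (2 : Fin 3)))).smulRight (rotGen x))) x := by
  have hA := hasFDerivAt_comp_meridian hx hα
  have hB := hasFDerivAt_comp_meridian hx hβ
  have hC := hasFDerivAt_comp_meridian hx hγ
  have hH : HasFDerivAt (fun y : EuclideanSpace ℝ (Fin 3) =>
      (WithLp.toLp 2 ![y 0, y 1, 0] : EuclideanSpace ℝ (Fin 3)))
      (ContinuousLinearMap.id ℝ (EuclideanSpace ℝ (Fin 3)) -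
        (EuclideanSpace.proj (2 : Fin 3) : EuclideanSpace ℝ (Fin 3) →L[ℝ] ℝ).smulRight eZ) x := by
    have e : (fun y : EuclideanSpace ℝ (Fin 3) => (WithLp.toLp 2 ![y 0, y 1, 0] : EuclideanSpace ℝ (Fin 3))) =
        ⇑(ContinuousLinearMap.id ℝ (EuclideanSpace ℝ (Fin 3)) -
          (EuclideanSpace.proj (2 : Fin 3) : EuclideanSpace ℝ (Fin 3) →L[ℝ] ℝ).smulRight eZ) :=
      funext horizontal_eq_clm
    rw [e]
    exact ContinuousLinearMap.hasFDerivAt _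
  have h1 := hA.smul hH
  have h2 := hB.smul_const (eZ : EuclideanSpace ℝ (Fin 3))
  have h3 := hC.smul (hasFDerivAt_rotGen x)
  have h := (h1.add h2).add h3
  have e : (fun y : EuclideanSpace ℝ (Fin 3) =>
      α (meridian y) • (WithLp.toLp 2 ![y 0, y 1, 0] : EuclideanSpace ℝ (Fin 3)) +
        β (meridian y) • eZ + γ (meridian y) • rotGen y) =
      ((fun y => α (meridian y)) • (fun y : EuclideanSpace ℝ (Fin 3) =>
          (WithLp.toLp 2 ![y 0, y 1, 0] : EuclideanSpace ℝ (Fin 3))) +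
        fun y => β (meridian y) • (eZ : EuclideanSpace ℝ (Fin 3))) +
        (fun y => γ (meridian y)) • rotGen := by
    funext y; simp only [Pi.add_apply, Pi.smul_apply']
  rw [e]
  exact h

/-- **Norm of that derivative**: with `q = R⁻¹x`,
`‖D(…)(x)‖ ≤ |α(q)| + ‖Dα(q)‖‖x‖ + ‖Dβ(q)‖ + |γ(q)| + ‖Dγ(q)‖‖x‖` (the meridian derivative and the
two linear frame fields have operator norm `≤ 1`, `‖(x₀,x₁,0)‖, ‖Jx‖ ≤ ‖x‖`, `‖x̂_axis‖ = 1`).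
[folklore] -/
theorem norm_fderiv_frameComb_le {α β γ : ℝ × ℝ → ℝ} {x : EuclideanSpace ℝ (Fin 3)}
    (hx : cylRadius x ≠ 0) (hα : DifferentiableAt ℝ α (meridian x))
    (hβ : DifferentiableAt ℝ β (meridian x)) (hγ : DifferentiableAt ℝ γ (meridian x)) :
    ‖fderiv ℝ (fun y : EuclideanSpace ℝ (Fin 3) =>
        α (meridian y) • (WithLp.toLp 2 ![y 0, y 1, 0] : EuclideanSpace ℝ (Fin 3)) +
          β (meridian y) • eZ + γ (meridian y) • rotGen y) x‖ ≤
      |α (meridian x)| + ‖fderiv ℝ α (meridian x)‖ * ‖x‖ + ‖fderiv ℝ β (meridian x)‖ +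
        |γ (meridian x)| + ‖fderiv ℝ γ (meridian x)‖ * ‖x‖ := by
  rw [(hasFDerivAt_frameComb hx hα hβ hγ).fderiv]
  set M : EuclideanSpace ℝ (Fin 3) →L[ℝ] ℝ × ℝ :=
    (innerSL ℝ (eR x)).prod (EuclideanSpace.proj (2 : Fin 3)) with hM
  have hMn : ‖M‖ ≤ 1 := IsNSIStructure.norm_meridianDeriv_le hx
  have hcomp : ∀ φ' : ℝ × ℝ →L[ℝ] ℝ, ‖φ'.comp M‖ ≤ ‖φ'‖ := fun φ' =>
    (φ'.opNorm_comp_le M).trans (by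
      calc ‖φ'‖ * ‖M‖ ≤ ‖φ'‖ * 1 := mul_le_mul_of_nonneg_left hMn (norm_nonneg _)
        _ = ‖φ'‖ := mul_one _)
  have t1 : ‖α (meridian x) • (ContinuousLinearMap.id ℝ (EuclideanSpace ℝ (Fin 3)) -
      (EuclideanSpace.proj (2 : Fin 3) : EuclideanSpace ℝ (Fin 3) →L[ℝ] ℝ).smulRight eZ)‖ ≤
      |α (meridian x)| := by
    rw [norm_smul, Real.norm_eq_abs]
    calc |α (meridian x)| * _ ≤ |α (meridian x)| * 1 :=
          mul_le_mul_of_nonneg_left norm_horizontalL_le (abs_nonneg _)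
      _ = |α (meridian x)| := mul_one _
  have t2 : ‖((fderiv ℝ α (meridian x)).comp M).smulRight
      (WithLp.toLp 2 ![x 0, x 1, 0] : EuclideanSpace ℝ (Fin 3))‖ ≤ ‖fderiv ℝ α (meridian x)‖ * ‖x‖ := by
    rw [ContinuousLinearMap.norm_smulRight_apply]
    exact mul_le_mul (hcomp _) (norm_horizontal_le x) (norm_nonneg _) (norm_nonneg _)
  have t3 : ‖((fderiv ℝ β (meridian x)).comp M).smulRight (eZ : EuclideanSpace ℝ (Fin 3))‖ ≤
      ‖fderiv ℝ β (meridian x)‖ := by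
    rw [ContinuousLinearMap.norm_smulRight_apply, norm_eZ_eq_one, mul_one]
    exact hcomp _
  have t4 : ‖γ (meridian x) • (rotGenL : EuclideanSpace ℝ (Fin 3) →L[ℝ] EuclideanSpace ℝ (Fin 3))‖ ≤
      |γ (meridian x)| := by
    rw [norm_smul, Real.norm_eq_abs]
    calc |γ (meridian x)| * _ ≤ |γ (meridian x)| * 1 :=
          mul_le_mul_of_nonneg_left norm_rotGenL_le (abs_nonneg _)
      _ = |γ (meridian x)| := mul_one _
  have t5 : ‖((fderiv ℝ γ (meridian x)).comp M).smulRight (rotGen x)‖ ≤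
      ‖fderiv ℝ γ (meridian x)‖ * ‖x‖ := by
    rw [ContinuousLinearMap.norm_smulRight_apply]
    exact mul_le_mul (hcomp _) (norm_rotGen_le x) (norm_nonneg _) (norm_nonneg _)
  calc _ ≤ ‖α (meridian x) • (ContinuousLinearMap.id ℝ (EuclideanSpace ℝ (Fin 3)) -
            (EuclideanSpace.proj (2 : Fin 3) : EuclideanSpace ℝ (Fin 3) →L[ℝ] ℝ).smulRight eZ) +
          ((fderiv ℝ α (meridian x)).comp M).smulRight
            (WithLp.toLp 2 ![x 0, x 1, 0] : EuclideanSpace ℝ (Fin 3))‖ +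
        ‖((fderiv ℝ β (meridian x)).comp M).smulRight (eZ : EuclideanSpace ℝ (Fin 3))‖ +
        ‖γ (meridian x) • (rotGenL : EuclideanSpace ℝ (Fin 3) →L[ℝ] EuclideanSpace ℝ (Fin 3)) +
          ((fderiv ℝ γ (meridian x)).comp M).smulRight (rotGen x)‖ := norm_add₃_le
    _ ≤ (|α (meridian x)| + ‖fderiv ℝ α (meridian x)‖ * ‖x‖) + ‖fderiv ℝ β (meridian x)‖ +
        (|γ (meridian x)| + ‖fderiv ℝ γ (meridian x)‖ * ‖x‖) :=
        add_le_add (add_le_add ((norm_add_le _ _).trans (add_le_add t1 t2)) t3)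
          ((norm_add_le _ _).trans (add_le_add t4 t5))
    _ = _ := by ring

/-! ### `u·Δu = ½Δ(q² ∘ R⁻¹) - |∇u|²` for slice data -/

namespace IsNSISlice

variable {U : Set (ℝ × ℝ)} {w : ℝ × ℝ → ℝ × ℝ} {g : ℝ × ℝ → ℝ}

/-- `|u[w,g]|² = g² ∘ R⁻¹` as functions. [cite: Ozanski2017NSISingular, §3.3 (3.11)] -/
theorem inner_self_eq (h : IsNSISlice U w g) :
    (fun y => ⟪swirlField w g y, swirlField w g y⟫) = fun y => g (meridian y) ^ 2 := by
  funext y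
  rw [real_inner_self_eq_norm_sq, h.norm_swirlField_eq y]

/-- `g² ∘ R⁻¹` is `C^∞` on `ℝ³` (it is `|u[w,g]|²`). [folklore] -/
theorem contDiff_sq_comp_meridian (h : IsNSISlice U w g) :
    ContDiff ℝ ∞ fun y : EuclideanSpace ℝ (Fin 3) => g (meridian y) ^ 2 := by
  have e : (fun y : EuclideanSpace ℝ (Fin 3) => g (meridian y) ^ 2) =
      fun y => ‖swirlField w g y‖ ^ 2 := by
    funext y; rw [h.norm_swirlField_eq y]
  rw [e]
  exact h.contDiff_swirlField.norm_sq ℝ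

/-- **`u·Δu = ½Δ(g² ∘ R⁻¹) - |∇u|²`** for `u = u[w,g]` (the identity `Δ|u|² = 2u·Δu + 2|∇u|²`, the
tree's `laplacian_inner_self_eq`, with `|u|² = g² ∘ R⁻¹`). [folklore] -/
theorem inner_laplacian_eq_half_sub (h : IsNSISlice U w g) (x : EuclideanSpace ℝ (Fin 3)) :
    ⟪swirlField w g x, (Δ (swirlField w g)) x⟫ =
      1 / 2 * (Δ fun y : EuclideanSpace ℝ (Fin 3) => g (meridian y) ^ 2) x -
        frobeniusNormSq (fderiv ℝ (swirlField w g) x) := by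
  have hid := laplacian_inner_self_eq (contDiff_infty.1 h.contDiff_swirlField 2) x
  rw [h.inner_self_eq] at hid
  rw [real_inner_comm, hid]
  ring

/-- **`Δ(g² ∘ R⁻¹)(x) = (∂ᵣ∂ᵣ + r⁻¹∂ᵣ + ∂_z∂_z)(g²)(R⁻¹x)`** off the axis. [folklore] -/
theorem laplacian_sq_comp_meridian (h : IsNSISlice U w g) {x : EuclideanSpace ℝ (Fin 3)}
    (hx : cylRadius x ≠ 0) :
    (Δ fun y : EuclideanSpace ℝ (Fin 3) => g (meridian y) ^ 2) x =
      derivR (derivR fun q => g q ^ 2) (meridian x) +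
        (meridian x).1⁻¹ * derivR (fun q => g q ^ 2) (meridian x) +
        derivZ (derivZ fun q => g q ^ 2) (meridian x) :=
  laplacian_comp_meridian (γ := fun q => g q ^ 2) (contDiff_infty.1 h.contDiff_sq_comp_meridian 2) hx

end IsNSISlice

/-! ### Compactness constants of the fixed data -/

/-- A continuous function on a compact set in a product is bounded there: the bound as a
number `B ≥ 0` with `|F| ≤ B` on the set. [folklore] -/
theorem exists_abs_le_of_continuousOn {X : Type*} [TopologicalSpace X] {K : Set X} (hK : IsCompact K)
    {F : X → ℝ} (hF : ContinuousOn F K) : ∃ B : ℝ, 0 ≤ B ∧ ∀ p ∈ K, |F p| ≤ B := by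
  obtain ⟨B, hB⟩ := hK.exists_bound_of_continuousOn hF
  exact ⟨max B 0, le_max_right _ _, fun p hp =>
    ((Real.norm_eq_abs _).symm.le.trans (hB p hp)).trans (le_max_left _ _)⟩

namespace IsNSIStructure

variable {U : Set (ℝ × ℝ)} {v : ℝ × ℝ → ℝ × ℝ} {f φ ψ : ℝ × ℝ → ℝ}

/-- `{φ ≥ 1/2}` is a compact subset of `U`. [folklore] -/
theorem isCompact_setOf_half_le (hS : IsNSIStructure U v f φ) : IsCompact {q | 1 / 2 ≤ φ q} :=
  hS.isCompact_tsupport_φ.of_isClosed_subset (isClosed_le continuous_const hS.φ_smooth.continuous)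
    fun q hq => subset_tsupport _ (by
      simp only [mem_setOf_eq] at hq
      rw [mem_support]; intro h0; rw [h0] at hq; norm_num at hq)

/-- `{φ ≥ 1/2} ⊆ U`. [folklore] -/
theorem setOf_half_le_subset (hS : IsNSIStructure U v f φ) : {q | 1 / 2 ≤ φ q} ⊆ U := fun q hq =>
  hS.tsupport_φ (subset_tsupport _ (by
    simp only [mem_setOf_eq] at hq
    rw [mem_support]; intro h0; rw [h0] at hq; norm_num at hq))

/-- **The uniform margin `μ₀`**: `h_t(q)² - |v(q)|² ≥ μ₀ > 0` on `[0,T] × {φ ≥ 1/2}` for a jointly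
continuous family of structures `(v, h_t)` (`h_t > |v|` on `U ⊇ {φ ≥ 1/2}`, compactness).
[cite: Ozanski2017NSISingular, §6.3 Step 2 (structures) and §4.1 (4.19)] -/
theorem exists_uniform_margin (hS : IsNSIStructure U v f φ) {H : ℝ → ℝ × ℝ → ℝ}
    (hH : ContDiff ℝ ∞ (uncurry H)) (hHstr : ∀ t : ℝ, IsNSIStructure U v (H t) ψ) (T : ℝ) :
    ∃ μ₀ > 0, ∀ t ∈ Icc (0 : ℝ) T, ∀ q, 1 / 2 ≤ φ q →
      (v q).1 ^ 2 + (v q).2 ^ 2 + μ₀ ≤ H t q ^ 2 := by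
  set K : Set (ℝ × (ℝ × ℝ)) := Icc (0 : ℝ) T ×ˢ {q | 1 / 2 ≤ φ q} with hK
  have hKc : IsCompact K := isCompact_Icc.prod hS.isCompact_setOf_half_le
  set F : ℝ × (ℝ × ℝ) → ℝ := fun p => H p.1 p.2 ^ 2 - ((v p.2).1 ^ 2 + (v p.2).2 ^ 2)
  have hv : Continuous fun p : ℝ × (ℝ × ℝ) => v p.2 := hS.v_smooth.continuous.comp continuous_snd
  have hFc : Continuous F := (hH.continuous.pow 2).sub
    (((continuous_fst.comp hv).pow 2).add ((continuous_snd.comp hv).pow 2))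
  have hpos : ∀ p ∈ K, 0 < F p := by
    rintro ⟨t, q⟩ ⟨-, hq⟩
    have := (hHstr t).sq_lt q (hS.setOf_half_le_subset hq)
    simp only [F]; linarith
  rcases K.eq_empty_or_nonempty with hE | hE
  · refine ⟨1, one_pos, fun t ht q hq => ?_⟩
    have : ((t, q) : ℝ × (ℝ × ℝ)) ∈ K := ⟨ht, hq⟩
    rw [hE] at this; exact this.elim
  · obtain ⟨p₀, hp₀, hmin⟩ := hKc.exists_isMinOn hE hFc.continuousOn
    refine ⟨F p₀, hpos p₀ hp₀, fun t ht q hq => ?_⟩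
    have := hmin (show ((t, q) : ℝ × (ℝ × ℝ)) ∈ K from ⟨ht, hq⟩)
    simp only [mem_setOf_eq, F] at this
    linarith

/-! ### The uniform bounds -/

set_option maxHeartbeats 800000 in
/-- **Uniform bounds for the fields `u[bv, q]` near the profiles `h_t`** (Ożański 2017, §6.3
Step 3: the constants of (6.26) and of (iv) do not depend on `j`). Let `(v, f, φ)` be a structure
on `U` and `H : ℝ → ℝ² → ℝ` jointly `C^∞` with `(bv, H t, ψ)` structures on `U` for all `t` and
`|b| ≤ 1` (Lemma 4.1). Then there are `ε₀ > 0` and `Λ ≥ 0` such that for every `t ∈ [0,T]`,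
every `|b| ≤ 1` and every profile `q` with `(bv, q, χ)` a structure on `U`, `q = H t` on `{φ < 1}`
and `|q² - (H t)²|, ‖∇(q² - (H t)²)‖, ‖∇²(q² - (H t)²)‖ ≤ ε₀` pointwise ((6.21)–(6.22)):
`q² ≤ Λ`, `|∇u[bv,q](x)|² ≤ Λ` and `u[bv,q](x)·Δu[bv,q](x) ≥ -Λ` for all `x ∈ ℝ³` — which is what
"`|v| ≤ 𝒞`", "`|∇v| ≤ 𝒞`" (Step 3, (iv)) and (6.26) consume, with `𝒞`, `ν₀` independent of `j`.
[cite: Ozanski2017NSISingular, §6.3 Step 3 ((6.26) and (iv))] -/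
theorem exists_uniform_swirl_bounds (hS : IsNSIStructure U v f φ) {H : ℝ → ℝ × ℝ → ℝ}
    (hH : ContDiff ℝ ∞ (uncurry H))
    (hHstr : ∀ t : ℝ, ∀ b : ℝ, |b| ≤ 1 → IsNSIStructure U (b • v) (H t) ψ) (T : ℝ) :
    ∃ ε₀ > 0, ∃ Λ : ℝ, 0 ≤ Λ ∧ ∀ t ∈ Icc (0 : ℝ) T, ∀ b : ℝ, |b| ≤ 1 →
      ∀ (Q χ : ℝ × ℝ → ℝ), IsNSIStructure U (b • v) Q χ →
      (∀ q, φ q < 1 → Q q = H t q) →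
      (∀ q, |Q q ^ 2 - H t q ^ 2| ≤ ε₀) →
      (∀ q, ‖fderiv ℝ (fun y => Q y ^ 2 - H t y ^ 2) q‖ ≤ ε₀) →
      (∀ q, ‖fderiv ℝ (fderiv ℝ fun y => Q y ^ 2 - H t y ^ 2) q‖ ≤ ε₀) →
      (∀ q, Q q ^ 2 ≤ Λ) ∧
      ∀ x : EuclideanSpace ℝ (Fin 3),
        frobeniusNormSq (fderiv ℝ (swirlField (b • v) Q) x) ≤ Λ ∧
        -Λ ≤ ⟪swirlField (b • v) Q x, (Δ (swirlField (b • v) Q)) x⟫ := by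
  have hH1 : ∀ t, IsNSIStructure U v (H t) ψ := fun t => by simpa using hHstr t 1 (by norm_num)
  -- the fixed constants: axis margin, size of `R(Ū)`, margin `μ₀`
  obtain ⟨r₀, hr₀, hr⟩ := hS.exists_axis_margin
  obtain ⟨μ₀, hμ₀, hμ⟩ := hS.exists_uniform_margin hH hH1 T
  obtain ⟨R₁, hR₁0, hR₁⟩ : ∃ R₁ : ℝ, 0 ≤ R₁ ∧ ∀ x ∈ revolve (closure U), ‖x‖ ≤ R₁ := by
    obtain ⟨B, hB0, hB⟩ := exists_abs_le_of_continuousOn (isCompact_revolve hS.isCompact_closure)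
      (continuous_norm.continuousOn (s := revolve (closure U)))
    exact ⟨B, hB0, fun x hx => (le_abs_self _).trans (hB x hx)⟩
  -- the compact parameter set `[0,T] × Ū` and the sups of the `H`-quantities
  set K : Set (ℝ × (ℝ × ℝ)) := Icc (0 : ℝ) T ×ˢ closure U with hK
  have hKc : IsCompact K := isCompact_Icc.prod hS.isCompact_closure
  have hH2 : ContDiff ℝ ∞ (uncurry fun (t : ℝ) (q : ℝ × ℝ) => H t q ^ 2) := hH.pow 2
  have cH : Continuous fun p : ℝ × (ℝ × ℝ) => H p.1 p.2 := hH.continuous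
  have cdR : Continuous fun p : ℝ × (ℝ × ℝ) => derivR (H p.1) p.2 := hH.derivR_param.continuous
  have cdZ : Continuous fun p : ℝ × (ℝ × ℝ) => derivZ (H p.1) p.2 := hH.derivZ_param.continuous
  have cdR2 : Continuous fun p : ℝ × (ℝ × ℝ) => derivR (fun y => H p.1 y ^ 2) p.2 :=
    (hH2.derivR_param (P := fun t q => H t q ^ 2)).continuous
  have cdZ2 : Continuous fun p : ℝ × (ℝ × ℝ) => derivZ (fun y => H p.1 y ^ 2) p.2 :=
    (hH2.derivZ_param (P := fun t q => H t q ^ 2)).continuous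
  have cdRR2 : Continuous fun p : ℝ × (ℝ × ℝ) => derivR (derivR fun y => H p.1 y ^ 2) p.2 :=
    ((hH2.derivR_param (P := fun t q => H t q ^ 2)).derivR_param
      (P := fun t q => derivR (fun y => H t y ^ 2) q)).continuous
  have cdZZ2 : Continuous fun p : ℝ × (ℝ × ℝ) => derivZ (derivZ fun y => H p.1 y ^ 2) p.2 :=
    ((hH2.derivZ_param (P := fun t q => H t q ^ 2)).derivZ_param
      (P := fun t q => derivZ (fun y => H t y ^ 2) q)).continuous
  have hKfst : ∀ p ∈ K, r₀ ≤ p.2.1 := fun p hp => hr _ hp.2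
  obtain ⟨KH, hKH0, hKH⟩ := exists_abs_le_of_continuousOn hKc cH.continuousOn
  obtain ⟨KdH, hKdH0, hKdH⟩ := exists_abs_le_of_continuousOn hKc
    (F := fun p : ℝ × (ℝ × ℝ) => |derivR (H p.1) p.2| + |derivZ (H p.1) p.2|)
    ((cdR.abs.add cdZ.abs).continuousOn (s := K))
  obtain ⟨KdH2, hKdH20, hKdH2⟩ := exists_abs_le_of_continuousOn hKc
    (F := fun p : ℝ × (ℝ × ℝ) => |derivR (fun y => H p.1 y ^ 2) p.2| + |derivZ (fun y => H p.1 y ^ 2) p.2|)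
    ((cdR2.abs.add cdZ2.abs).continuousOn (s := K))
  have cinv : ContinuousOn (fun p : ℝ × (ℝ × ℝ) => p.2.1⁻¹) K :=
    (continuous_fst.comp continuous_snd).continuousOn.inv₀ fun p hp => (hr₀.trans_le (hKfst p hp)).ne'
  obtain ⟨Klap, hKlap0, hKlap⟩ := exists_abs_le_of_continuousOn hKc
    (F := fun p : ℝ × (ℝ × ℝ) => derivR (derivR fun y => H p.1 y ^ 2) p.2 +
      p.2.1⁻¹ * derivR (fun y => H p.1 y ^ 2) p.2 + derivZ (derivZ fun y => H p.1 y ^ 2) p.2)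
    ((cdRR2.continuousOn.add (cinv.mul cdR2.continuousOn)).add cdZZ2.continuousOn)
  -- the `v`-quantities on `Ū`
  have hv0 : ∀ q : ℝ × ℝ, q.1 < r₀ → v q = 0 := fun q hq =>
    hS.v_eq_zero fun h' => (hr q h').not_gt hq
  have hAfun : ContDiff ℝ ∞ fun q : ℝ × ℝ => (v q).1 * q.1⁻¹ :=
    contDiff_mul_inv_fst_of_eq_zero (contDiff_fst.comp hS.v_smooth) hr₀ fun q hq => by simp [hv0 q hq]
  have hBfun : ContDiff ℝ ∞ fun q : ℝ × ℝ => (v q).2 := contDiff_snd.comp hS.v_smooth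
  have hV2fun : ContDiff ℝ ∞ fun q : ℝ × ℝ => (v q).1 ^ 2 + (v q).2 ^ 2 :=
    ((contDiff_fst.comp hS.v_smooth).pow 2).add ((contDiff_snd.comp hS.v_smooth).pow 2)
  have hUc := hS.isCompact_closure
  obtain ⟨KA, hKA0, hKA⟩ := exists_abs_le_of_continuousOn hUc hAfun.continuous.continuousOn
  obtain ⟨KdA, hKdA0, hKdA⟩ := exists_abs_le_of_continuousOn hUc
    (hAfun.continuous_fderiv (by simp)).norm.continuousOn
  obtain ⟨KdB, hKdB0, hKdB⟩ := exists_abs_le_of_continuousOn hUc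
    (hBfun.continuous_fderiv (by simp)).norm.continuousOn
  obtain ⟨KdV2, hKdV20, hKdV2⟩ := exists_abs_le_of_continuousOn hUc
    (hV2fun.continuous_fderiv (by simp)).norm.continuousOn
  -- the tolerance and the constant
  set ε₀ : ℝ := min 1 (μ₀ / 2) with hε₀
  have hε₀1 : ε₀ ≤ 1 := min_le_left _ _
  have hε₀μ : ε₀ ≤ μ₀ / 2 := min_le_right _ _
  have hε₀0 : 0 < ε₀ := lt_min one_pos (by positivity)
  set σ₀ : ℝ := Real.sqrt (μ₀ / 2) with hσ₀
  have hσ₀0 : 0 < σ₀ := Real.sqrt_pos.2 (by positivity)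
  set KdS : ℝ := KdH + (1 + KdH2 + KdV2) / (2 * σ₀) with hKdS
  have hKdS0 : 0 ≤ KdS := by positivity
  set KdΓ : ℝ := (KH + 1) * (r₀ ^ 2)⁻¹ + r₀⁻¹ * KdS with hKdΓ
  have hKdΓ0 : 0 ≤ KdΓ := by positivity
  set Λ₁ : ℝ := KA + KdA * R₁ + KdB + (KH + 1) * r₀⁻¹ + KdΓ * R₁ with hΛ₁
  have hΛ₁0 : 0 ≤ Λ₁ := by positivity
  set Λ : ℝ := 3 * Λ₁ ^ 2 + (Klap + 3 + r₀⁻¹) + (KH ^ 2 + 1) with hΛ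
  have hΛ0 : 0 ≤ Λ := by positivity
  refine ⟨ε₀, hε₀0, Λ, hΛ0, ?_⟩
  intro t ht b hb Q χ hQ hQH h0 h1 h2
  have hslice : IsNSISlice U (b • v) Q := hQ.isNSISlice
  have hHt : ContDiff ℝ ∞ (H t) := hH.slice_param t
  have hHt2 : ContDiff ℝ ∞ fun y => H t y ^ 2 := hHt.pow 2
  have hQ2 : ContDiff ℝ ∞ fun y => Q y ^ 2 := hQ.f_smooth.pow 2
  have hb2 : b ^ 2 ≤ 1 := by
    have h := pow_le_pow_left₀ (abs_nonneg b) hb 2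
    rwa [sq_abs, one_pow] at h
  -- `Q² ≤ KH² + 1` everywhere
  have hQsq : ∀ q, Q q ^ 2 ≤ KH ^ 2 + 1 := by
    intro q
    by_cases hq : q ∈ closure U
    · have h0q := (abs_le.1 (h0 q)).2
      have hHq : |H t q| ≤ KH := hKH (t, q) ⟨ht, hq⟩
      have hH2 : H t q ^ 2 ≤ KH ^ 2 := by
        have h := pow_le_pow_left₀ (abs_nonneg _) hHq 2
        rwa [sq_abs] at h
      linarith only [h0q, hε₀1, hH2]
    · rw [hQ.f_eq_zero hq, zero_pow two_ne_zero]
      positivity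
  have hQle : ∀ q, Q q ≤ KH + 1 := fun q => by
    have hsq1 : (KH + 1) ^ 2 = KH ^ 2 + 2 * KH + 1 := by ring
    have h1' : Q q ^ 2 ≤ (KH + 1) ^ 2 := (hQsq q).trans (by rw [hsq1]; linarith only [hKH0])
    exact pow_le_pow_iff_left₀ (hQ.f_nonneg q) (by positivity) two_ne_zero |>.1 h1'
  have hr₀i : 0 ≤ r₀⁻¹ := inv_nonneg.2 hr₀.le
  refine ⟨fun q => (hQsq q).trans (by
    rw [hΛ]; linarith only [sq_nonneg Λ₁, hKlap0, hr₀i]), fun x => ?_⟩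
  by_cases hx : meridian x ∈ closure U
  · -- the point lies over `Ū`: `q = R⁻¹x`, `r ≥ r₀`
    set q : ℝ × ℝ := meridian x with hqdef
    have hq1 : r₀ ≤ q.1 := hr q hx
    have hq0 : 0 < q.1 := hr₀.trans_le hq1
    have hxr : cylRadius x ≠ 0 := hq0.ne'
    have hxR : ‖x‖ ≤ R₁ := hR₁ x hx
    have hqi : q.1⁻¹ ≤ r₀⁻¹ := inv_anti₀ hr₀ hq1
    -- (1) the Laplacian of `Q² ∘ R⁻¹`
    have hlapQ : |(Δ fun y : EuclideanSpace ℝ (Fin 3) => Q (meridian y) ^ 2) x| ≤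
        Klap + (2 + r₀⁻¹) * ε₀ := by
      rw [hslice.laplacian_sq_comp_meridian hxr]
      have hpert := abs_planarLap_sub_le (g := fun y => Q y ^ 2) (h := fun y => H t y ^ 2) hQ2 hHt2
        hr₀ hq1 (h1 q) (h2 q)
      have hbase := hKlap (t, q) ⟨ht, hx⟩
      have key : ∀ a c : ℝ, |c| ≤ Klap → |a - c| ≤ (2 + r₀⁻¹) * ε₀ → |a| ≤ Klap + (2 + r₀⁻¹) * ε₀ :=
        fun a c hc hac => by
          have := abs_sub_abs_le_abs_sub a c
          linarith
      exact key _ _ hbase hpert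
    -- (2) the three planar coefficients of `u[bv, Q]` and their sizes at `q`
    set αf : ℝ × ℝ → ℝ := fun q' => ((b • v) q').1 * q'.1⁻¹ with hαf
    set βf : ℝ × ℝ → ℝ := fun q' => ((b • v) q').2 with hβf
    set Pf : ℝ × ℝ → ℝ := fun q' => Q q' ^ 2 - (((b • v) q').1 ^ 2 + ((b • v) q').2 ^ 2) with hPf
    set Sf : ℝ × ℝ → ℝ := fun q' => Real.sqrt (Pf q') with hSf
    set γf : ℝ × ℝ → ℝ := fun q' => Sf q' * q'.1⁻¹ with hγf
    have eα : αf = fun q' => b * ((v q').1 * q'.1⁻¹) := by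
      funext q'; simp only [hαf, Pi.smul_apply, Prod.smul_fst, smul_eq_mul]; ring
    have eβ : βf = fun q' => b * (v q').2 := by
      funext q'; simp only [hβf, Pi.smul_apply, Prod.smul_snd, smul_eq_mul]
    have eP : Pf = fun q' => Q q' ^ 2 - b ^ 2 * ((v q').1 ^ 2 + (v q').2 ^ 2) := by
      funext q'; simp only [hPf, Pi.smul_apply, Prod.smul_fst, Prod.smul_snd, smul_eq_mul]; ring
    -- `α`, `β`
    have hAd : DifferentiableAt ℝ (fun q' : ℝ × ℝ => (v q').1 * q'.1⁻¹) q :=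
      hAfun.differentiable (by simp) q
    have hBd : DifferentiableAt ℝ (fun q' : ℝ × ℝ => (v q').2) q := hBfun.differentiable (by simp) q
    have hαd : DifferentiableAt ℝ αf q := by rw [eα]; exact hAd.const_mul b
    have hβd : DifferentiableAt ℝ βf q := by rw [eβ]; exact hBd.const_mul b
    have hαv : |αf q| ≤ KA := by
      rw [eα]
      simp only
      rw [abs_mul]
      calc |b| * |(v q).1 * q.1⁻¹| ≤ 1 * KA := mul_le_mul hb (hKA q hx) (abs_nonneg _) zero_le_one
        _ = KA := one_mul _
    have hαD : ‖fderiv ℝ αf q‖ ≤ KdA := by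
      rw [eα, fderiv_const_mul hAd b, norm_smul, Real.norm_eq_abs]
      have := hKdA q hx
      rw [abs_of_nonneg (norm_nonneg _)] at this
      calc |b| * _ ≤ 1 * KdA := mul_le_mul hb this (norm_nonneg _) zero_le_one
        _ = KdA := one_mul _
    have hβD : ‖fderiv ℝ βf q‖ ≤ KdB := by
      rw [eβ, fderiv_const_mul hBd b, norm_smul, Real.norm_eq_abs]
      have := hKdB q hx
      rw [abs_of_nonneg (norm_nonneg _)] at this
      calc |b| * _ ≤ 1 * KdB := mul_le_mul hb this (norm_nonneg _) zero_le_one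
        _ = KdB := one_mul _
    -- `S = √P`: value and derivative, by the two regions `{φ < 1}`, `{φ = 1}`
    have hPle : ∀ q', Pf q' ≤ Q q' ^ 2 := fun q' => by
      rw [eP]
      have := mul_nonneg (sq_nonneg b) (add_nonneg (sq_nonneg (v q').1) (sq_nonneg (v q').2))
      linarith only [this]
    have hSv : |Sf q| ≤ KH + 1 := by
      rw [hSf]; simp only
      rw [abs_of_nonneg (Real.sqrt_nonneg _)]
      calc Real.sqrt (Pf q) ≤ Real.sqrt (Q q ^ 2) := Real.sqrt_le_sqrt (hPle q)
        _ = Q q := Real.sqrt_sq (hQ.f_nonneg q)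
        _ ≤ KH + 1 := hQle q
    have hSreg : DifferentiableAt ℝ Sf q ∧ ‖fderiv ℝ Sf q‖ ≤ KdS := by
      by_cases hφ : φ q < 1
      · -- region `{φ < 1}`: `S = H t` near `q`
        have hO : IsOpen {q' : ℝ × ℝ | φ q' < 1} := isOpen_lt hS.φ_smooth.continuous continuous_const
        have hev : Sf =ᶠ[𝓝 q] H t := by
          filter_upwards [hO.mem_nhds hφ] with q' hq'
          have hvq : v q' = 0 := hS.v_eq_zero_of_lt hq'
          simp only [hSf, hPf, Pi.smul_apply, hvq, smul_zero, Prod.fst_zero, Prod.snd_zero]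
          rw [show ((0 : ℝ) ^ 2 + (0 : ℝ) ^ 2) = 0 by norm_num, sub_zero, hQH q' hq',
            Real.sqrt_sq ((hH1 t).f_nonneg q')]
        have hHd : DifferentiableAt ℝ (H t) q := hHt.differentiable (by simp) q
        refine ⟨hHd.congr_of_eventuallyEq hev, ?_⟩
        rw [hev.fderiv_eq]
        have hK := hKdH (t, q) ⟨ht, hx⟩
        rw [abs_of_nonneg (by positivity)] at hK
        calc ‖fderiv ℝ (H t) q‖ ≤ |derivR (H t) q| + |derivZ (H t) q| := norm_fderiv_le_abs_add _ _
          _ ≤ KdH := hK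
          _ ≤ KdS := by rw [hKdS]; exact le_add_of_nonneg_right (by positivity)
      · -- region `{φ = 1}`: the radicand stays `≥ μ₀/2` near `q`
        have hφ1 : φ q = 1 := le_antisymm (hS.φ_mem q).2 (not_lt.1 hφ)
        have hO : IsOpen {q' : ℝ × ℝ | 1 / 2 < φ q'} := isOpen_lt continuous_const hS.φ_smooth.continuous
        have hqO : q ∈ {q' : ℝ × ℝ | 1 / 2 < φ q'} := by
          simp only [mem_setOf_eq, hφ1]; norm_num
        have hPlow : ∀ q' ∈ {q' : ℝ × ℝ | 1 / 2 < φ q'}, μ₀ / 2 ≤ Pf q' := by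
          intro q' hq'
          have hm := hμ t ht q' (le_of_lt hq')
          have hc := (abs_le.1 (h0 q')).1
          have hbv : b ^ 2 * ((v q').1 ^ 2 + (v q').2 ^ 2) ≤ (v q').1 ^ 2 + (v q').2 ^ 2 :=
            mul_le_of_le_one_left (add_nonneg (sq_nonneg _) (sq_nonneg _)) hb2
          rw [eP]
          linarith only [hm, hc, hε₀μ, hbv]
        have hPq : μ₀ / 2 ≤ Pf q := hPlow q hqO
        have hPq0 : Pf q ≠ 0 := (lt_of_lt_of_le (by positivity) hPq).ne'
        have hPs : ContDiff ℝ ∞ Pf := by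
          rw [eP]
          exact hQ2.sub (contDiff_const.mul hV2fun)
        have hPd : DifferentiableAt ℝ Pf q := hPs.differentiable (by simp) q
        have hSder : HasFDerivAt Sf ((1 / (2 * Real.sqrt (Pf q))) • fderiv ℝ Pf q) q :=
          hPd.hasFDerivAt.sqrt hPq0
        refine ⟨hSder.differentiableAt, ?_⟩
        rw [hSder.fderiv, norm_smul, Real.norm_eq_abs, abs_of_nonneg (by positivity)]
        -- `‖DP(q)‖ ≤ ε₀ + ‖D(H²)(q)‖ + b²‖D|v|²(q)‖`
        have hV2d : DifferentiableAt ℝ (fun q' : ℝ × ℝ => (v q').1 ^ 2 + (v q').2 ^ 2) q :=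
          hV2fun.differentiable (by simp) q
        have hDd : DifferentiableAt ℝ (fun y => Q y ^ 2 - H t y ^ 2) q :=
          (hQ2.sub hHt2).differentiable (by simp) q
        have hH2d : DifferentiableAt ℝ (fun y => H t y ^ 2) q := hHt2.differentiable (by simp) q
        have eP' : Pf = fun q' => (Q q' ^ 2 - H t q' ^ 2) +
            (H t q' ^ 2 - b ^ 2 * ((v q').1 ^ 2 + (v q').2 ^ 2)) := by
          rw [eP]; funext q'; ring
        have hfP : fderiv ℝ Pf q = fderiv ℝ (fun y => Q y ^ 2 - H t y ^ 2) q +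
            (fderiv ℝ (fun y => H t y ^ 2) q -
              b ^ 2 • fderiv ℝ (fun q' : ℝ × ℝ => (v q').1 ^ 2 + (v q').2 ^ 2) q) := by
          rw [eP', fderiv_fun_add hDd (hH2d.fun_sub (hV2d.const_mul _)),
            fderiv_fun_sub hH2d (hV2d.const_mul _), fderiv_const_mul hV2d]
        have hnP : ‖fderiv ℝ Pf q‖ ≤ 1 + KdH2 + KdV2 := by
          rw [hfP]
          have hK2 := hKdH2 (t, q) ⟨ht, hx⟩
          rw [abs_of_nonneg (by positivity)] at hK2
          have hKV := hKdV2 q hx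
          rw [abs_of_nonneg (norm_nonneg _)] at hKV
          calc _ ≤ ‖fderiv ℝ (fun y => Q y ^ 2 - H t y ^ 2) q‖ +
                ‖fderiv ℝ (fun y => H t y ^ 2) q -
                  b ^ 2 • fderiv ℝ (fun q' : ℝ × ℝ => (v q').1 ^ 2 + (v q').2 ^ 2) q‖ := norm_add_le _ _
            _ ≤ ε₀ + (‖fderiv ℝ (fun y => H t y ^ 2) q‖ +
                ‖b ^ 2 • fderiv ℝ (fun q' : ℝ × ℝ => (v q').1 ^ 2 + (v q').2 ^ 2) q‖) :=
                add_le_add (h1 q) (norm_sub_le _ _)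
            _ ≤ 1 + ((|derivR (fun y => H t y ^ 2) q| + |derivZ (fun y => H t y ^ 2) q|) + 1 * KdV2) := by
                refine add_le_add hε₀1 (add_le_add (norm_fderiv_le_abs_add _ _) ?_)
                rw [norm_smul, Real.norm_eq_abs, abs_of_nonneg (sq_nonneg b)]
                exact mul_le_mul hb2 hKV (norm_nonneg _) zero_le_one
            _ ≤ 1 + KdH2 + KdV2 := by linarith
        have hsq : σ₀ ≤ Real.sqrt (Pf q) := Real.sqrt_le_sqrt hPq
        calc 1 / (2 * Real.sqrt (Pf q)) * ‖fderiv ℝ Pf q‖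
            ≤ 1 / (2 * σ₀) * (1 + KdH2 + KdV2) := by
              refine mul_le_mul ?_ hnP (norm_nonneg _) (by positivity)
              exact one_div_le_one_div_of_le (by positivity) (by linarith)
          _ = (1 + KdH2 + KdV2) / (2 * σ₀) := by ring
          _ ≤ KdS := by rw [hKdS]; exact le_add_of_nonneg_left hKdH0
    obtain ⟨hSd, hSD⟩ := hSreg
    -- `γ = S / r`
    have hfinv : DifferentiableAt ℝ (fun q' : ℝ × ℝ => q'.1⁻¹) q := differentiableAt_fst.inv hq0.ne'
    have hγd : DifferentiableAt ℝ γf q := hSd.mul hfinv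
    have hγv : |γf q| ≤ (KH + 1) * r₀⁻¹ := by
      rw [hγf]; simp only
      rw [abs_mul, abs_of_pos (inv_pos.2 hq0)]
      exact mul_le_mul hSv hqi (inv_pos.2 hq0).le (by positivity)
    have hγD : ‖fderiv ℝ γf q‖ ≤ KdΓ := by
      rw [hγf, fderiv_fun_mul hSd hfinv]
      have hn1 : ‖Sf q • fderiv ℝ (fun q' : ℝ × ℝ => q'.1⁻¹) q‖ ≤ (KH + 1) * (r₀ ^ 2)⁻¹ := by
        rw [norm_smul, Real.norm_eq_abs]
        exact mul_le_mul hSv (norm_fderiv_inv_fst_le hr₀ hq1) (norm_nonneg _) (by positivity)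
      have hn2 : ‖(q.1⁻¹ : ℝ) • fderiv ℝ Sf q‖ ≤ r₀⁻¹ * KdS := by
        rw [norm_smul, Real.norm_eq_abs, abs_of_pos (inv_pos.2 hq0)]
        exact mul_le_mul hqi hSD (norm_nonneg _) (by positivity)
      calc _ ≤ ‖Sf q • fderiv ℝ (fun q' : ℝ × ℝ => q'.1⁻¹) q‖ + ‖(q.1⁻¹ : ℝ) • fderiv ℝ Sf q‖ :=
            norm_add_le _ _
        _ ≤ (KH + 1) * (r₀ ^ 2)⁻¹ + r₀⁻¹ * KdS := add_le_add hn1 hn2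
        _ = KdΓ := by rw [hKdΓ]
    -- (3) `‖Du(x)‖ ≤ Λ₁`
    have hfd : ‖fderiv ℝ (swirlField (b • v) Q) x‖ ≤ Λ₁ := by
      rw [swirlField_eq_linear]
      have hmain := norm_fderiv_frameComb_le (α := αf) (β := βf) (γ := γf) hxr hαd hβd hγd
      refine hmain.trans ?_
      rw [hΛ₁]
      have e1 : ‖fderiv ℝ αf q‖ * ‖x‖ ≤ KdA * R₁ := mul_le_mul hαD hxR (norm_nonneg _) hKdA0
      have e2 : ‖fderiv ℝ γf q‖ * ‖x‖ ≤ KdΓ * R₁ := mul_le_mul hγD hxR (norm_nonneg _) hKdΓ0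
      linarith
    have hfrob : frobeniusNormSq (fderiv ℝ (swirlField (b • v) Q) x) ≤ 3 * Λ₁ ^ 2 :=
      (frobeniusNormSq_le_three_mul _).trans
        (mul_le_mul_of_nonneg_left (pow_le_pow_left₀ (norm_nonneg _) hfd 2) (by norm_num))
    refine ⟨hfrob.trans (by rw [hΛ]; linarith only [sq_nonneg KH, hKlap0, hr₀i]), ?_⟩
    rw [hslice.inner_laplacian_eq_half_sub x]
    have hl := (abs_le.1 hlapQ).1
    have hε' : (2 + r₀⁻¹) * ε₀ ≤ 2 + r₀⁻¹ := by
      calc (2 + r₀⁻¹) * ε₀ ≤ (2 + r₀⁻¹) * 1 := mul_le_mul_of_nonneg_left hε₀1 (by positivity)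
        _ = 2 + r₀⁻¹ := mul_one _
    rw [hΛ]
    linarith only [sq_nonneg KH, hfrob, hl, hε', hKlap0, hr₀i]
  · -- off `R(Ū)`: the field vanishes near `x`
    have hO : IsOpen (revolve (closure U))ᶜ := (isClosed_closure.preimage continuous_meridian).isOpen_compl
    have hev : swirlField (b • v) Q =ᶠ[𝓝 x] fun _ => (0 : EuclideanSpace ℝ (Fin 3)) := by
      filter_upwards [hO.mem_nhds hx] with y hy
      exact hslice.swirlField_eq_zero hy
    refine ⟨?_, ?_⟩
    · rw [hev.fderiv_eq, fderiv_const_apply, frobeniusNormSq_zero]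
      exact hΛ0
    · rw [hslice.swirlField_eq_zero hx, inner_zero_left]
      linarith

end IsNSIStructure

end Literature.Barriers.NavierStokesRegularity
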